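import Mathlib
import HarnessLib.Audit
import Summits.PneNP.PneNP.Theorems.PstarForcing
import Summits.PneNP.PneNP.Theorems.PstarChordSystem

/-!
# Chord systems meet rank rigidity: pairwise killability (R4) and the forced-chord cases (ROUND-24, memo §9 R4/R5/R7, §10 (★★))

FRONTIER range-avoidance ladder, rung F-N3, ROUND 24 (cell `pnp-ideate`, planner memo `r24/CORE-BOUND-NOTES.md` §9 R4 ("PAIRWISE KILLABILITY:
`K_e ∩ K_{e'} ≠ ∅` for any two co-tree chords"), R5, R7 and §10 (★★); restricted-model proof complexity — nothing here bears on `P` versus `NP`).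

The algebra (`PstarForcing`) plugged into the abstract chord system (`PstarChordSystem`), on a finite `𝔽₂`-module `M` of base points:

* `zeros_meet` — **R4, pairwise killability.**  Two quadratics `Q, Q'` of rank `≥ 4` take prescribed values `γ, γ'` SIMULTANEOUSLY somewhere,
  unless `Q' = Q + κ` (same form; for path forms: the same path, `PstarForcing.edges_eq_of_qform_eq`) or `Q' = Q + ν₁ν₂ + κ` (the elliptic
  rank-four bundle exception).  So the killable sets `K_e = {u_e = 0}`, `u_e = γ_e + Q_{P_e}`, of two chords with different path forms meet —
  the hypothesis `hK` of `PstarChordSystem.ChordSystem.direction_collapse` (R5);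
* `forced_chord_cases` — **(★★) ⇒ R7.**  In an infeasible single-read chord system with constant reads, prescribed product
  `u_e = γ + Q` of the chord `e` (`Q` of rank `≥ 4`) and `q a := (F a).2 + t.2` quadratic (so `Z = Z(q)`), a chord-minimal `e` satisfies one of
  (EQ) `Q = q + κ`, (EXC) `Q = q + ν₁ν₂ + κ`, (NOR) the codimension-two flat form; the fourth case `Z = ∅` of `forcing_cases` is excluded because
  then NO chord is chord-minimal (`not_chordMinimal_of_Z_empty`).
-/

set_option linter.dupNamespace false -- `Summit.PneNP.PneNP.…`: summit = sub-problem name (D-0017 single-conjunct layout)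

open Finset Module
open Summit.PneNP.PneNP.Theorems.PstarCubeIdeals (IsAffineFn IsQuadFn isAffineFn_of_linear)
open Summit.PneNP.PneNP.Theorems.PstarQuadRank (rad)
open Summit.PneNP.PneNP.Theorems.PstarForcing (forcing_cases exists_ne_of_rank_four not_rank_four_of_mul)
open Summit.PneNP.PneNP.Theorems.PstarReadSumset (V2)
open Summit.PneNP.PneNP.Theorems.PstarChordSystem (ChordSystem)

namespace Summit.PneNP.PneNP.Theorems.PstarChordForcing

variable {M : Type*} [AddCommGroup M] [Module (ZMod 2) M] [Fintype M] [DecidableEq M]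

omit [Fintype M] [DecidableEq M] in
/-- Shifting by a constant keeps the polar form. -/
theorem polar_add_const {Q : M → ZMod 2} {B : LinearMap.BilinForm (ZMod 2) M} (hB : ∀ x w, Q (x + w) = Q x + Q w + Q 0 + B x w)
    (γ : ZMod 2) : ∀ x w, Q (x + w) + γ = (Q x + γ) + (Q w + γ) + (Q 0 + γ) + B x w := by
  intro x w
  rw [hB]
  generalize Q x = s; generalize Q w = s'; generalize Q 0 = s₀; generalize B x w = b
  revert s s' s₀ b γ; decide

omit [DecidableEq M] in
/-- **R4 — pairwise killability.**  Two quadratics of rank `≥ 4` take any prescribed pair of values simultaneously at some point, unless they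
differ by a constant or by a product of two affine functions plus a constant. -/
theorem zeros_meet {Q Q' : M → ZMod 2} {B B' : LinearMap.BilinForm (ZMod 2) M}
    (hB : ∀ x w, Q (x + w) = Q x + Q w + Q 0 + B x w) (hB' : ∀ x w, Q' (x + w) = Q' x + Q' w + Q' 0 + B' x w)
    (hrank : finrank (ZMod 2) (rad B) + 4 ≤ finrank (ZMod 2) M) (hrank' : finrank (ZMod 2) (rad B') + 4 ≤ finrank (ZMod 2) M)
    (γ γ' : ZMod 2) :
    (∃ a, Q a = γ ∧ Q' a = γ') ∨ (∃ κ : ZMod 2, ∀ x, Q' x = Q x + κ) ∨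
    (∃ ν₁ ν₂ : M → ZMod 2, IsAffineFn ν₁ ∧ IsAffineFn ν₂ ∧ ∃ κ : ZMod 2, ∀ x, Q' x = Q x + ν₁ x * ν₂ x + κ) := by
  classical
  by_cases hex : ∃ a, Q a = γ ∧ Q' a = γ'
  · exact Or.inl hex
  right
  push Not at hex
  -- `Q' ≡ γ' + 1` on `Z(Q + γ)`
  have hq : ∀ x w, (Q (x + w) + γ) = (Q x + γ) + (Q w + γ) + (Q 0 + γ) + B x w := polar_add_const hB γ
  have hZ : ∀ x, Q x + γ = 0 → Q' x = γ' + 1 := by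
    intro x hx
    have e0 : ∀ s g : ZMod 2, s + g = 0 → s = g := by decide
    have e1 : ∀ s g : ZMod 2, s ≠ g → s = g + 1 := by decide
    exact e1 _ _ (hex x (e0 _ _ hx))
  rcases forcing_cases hq hB' hrank' hZ with h | ⟨κ, h⟩ | ⟨ν₁, ν₂, hν₁, hν₂, κ, h⟩ | ⟨a, b, hab, hqf, -⟩
  · -- `Q + γ ≡ 1`: `Q` constant, contradicting its rank
    exfalso
    obtain ⟨v, hv⟩ := exists_ne_of_rank_four hB hrank
    have e2 : ∀ s s' g : ZMod 2, s + g = 1 → s' + g = 1 → s = s' := by decide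
    exact hv (e2 _ _ _ (h v) (h 0))
  · refine Or.inl ⟨κ + γ, fun x => ?_⟩
    rw [h x]; ring
  · refine Or.inr ⟨ν₁, ν₂, hν₁, hν₂, κ + γ, fun x => ?_⟩
    rw [h x]; ring
  · -- the NOR-flat shape has rank two: impossible for `Q + γ`
    exfalso
    have h₁ : IsAffineFn (fun x => B x b + (Q b + γ + (Q 0 + γ))) := isAffineFn_of_linear (B.flip b) _
    have h₂ : IsAffineFn (fun x => B x a + (Q a + γ + (Q 0 + γ))) := isAffineFn_of_linear (B.flip a) _
    exact not_rank_four_of_mul hq h₁ h₂ (κ := 1) (fun x => hqf x) hrank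

/-! ## Forced chords -/

variable {ι : Type*} [DecidableEq ι]

omit [DecidableEq M] in
/-- **Empty `Z` kills chord-minimality.**  In a single-read system whose second constraint is violated identically (`(F a).2 ≠ t.2` for all
`a`), no chord is chord-minimal. -/
theorem not_chordMinimal_of_Z_empty {A : Type*} (S : ChordSystem ι A) (hS : S.SingleRead) {E : Finset ι}
    (hZ : ∀ a, (S.F a).2 ≠ S.t.2) (e : ι) : ¬ S.ChordMinimal E e := by
  rintro ⟨a, s, -, hval⟩
  have h2 := congrArg Prod.snd hval
  rw [S.val_snd_of_singleRead hS] at h2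
  exact hZ a h2

omit [DecidableEq M] in
/-- **(★★) through the R7 table.**  Single-read chord system on the cube `M` with constant reads; second constraint `q a := (F a).2 + t.2`
quadratic with polar form `B`; chord `e ∈ E` with prescribed product `u_e = γ + Q` where `Q` is quadratic of rank `≥ 4`.  If the system is
infeasible and chord-minimal in `e`, then (EQ) `Q = q + κ`, or (EXC) `Q = q + ν₁ν₂ + κ`, or (NOR) `Z(q)` is the codimension-two flat
`{λ₁ = λ₂ = 1}` and `Q + γ + 1 = (λ₁+1)m₁ + (λ₂+1)m₂`. -/
theorem forced_chord_cases (S : ChordSystem ι M) (hS : S.SingleRead) (hconst : ∀ e a a', S.ρ e a = S.ρ e a' ∧ S.ρ' e a = S.ρ' e a')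
    {E : Finset ι} (hI : S.Infeasible E) {e : ι} (he : e ∈ E) (hM : S.ChordMinimal E e)
    {B : LinearMap.BilinForm (ZMod 2) M} (hB : ∀ x w, (S.F (x + w)).2 + S.t.2 = ((S.F x).2 + S.t.2) + ((S.F w).2 + S.t.2) + ((S.F 0).2 + S.t.2) + B x w)
    {Q : M → ZMod 2} {γ : ZMod 2} (hu : ∀ a, S.u e a = γ + Q a) {B' : LinearMap.BilinForm (ZMod 2) M}
    (hB' : ∀ x w, Q (x + w) = Q x + Q w + Q 0 + B' x w) (hrank : finrank (ZMod 2) (rad B') + 4 ≤ finrank (ZMod 2) M) :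
    (∃ κ : ZMod 2, ∀ x, Q x = ((S.F x).2 + S.t.2) + κ) ∨
    (∃ ν₁ ν₂ : M → ZMod 2, IsAffineFn ν₁ ∧ IsAffineFn ν₂ ∧ ∃ κ : ZMod 2, ∀ x, Q x = ((S.F x).2 + S.t.2) + ν₁ x * ν₂ x + κ) ∨
    (∃ a b : M, B a b = 1 ∧
      (∀ x, (S.F x).2 + S.t.2 = (B x b + (((S.F b).2 + S.t.2) + ((S.F 0).2 + S.t.2))) * (B x a + (((S.F a).2 + S.t.2) + ((S.F 0).2 + S.t.2))) + 1) ∧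
      ∃ m₁ m₂ : M → ZMod 2, IsAffineFn m₁ ∧ IsAffineFn m₂ ∧
        ∀ x, Q x + (γ + 1) = (B x b + (((S.F b).2 + S.t.2) + ((S.F 0).2 + S.t.2)) + 1) * m₁ x +
          (B x a + (((S.F a).2 + S.t.2) + ((S.F 0).2 + S.t.2)) + 1) * m₂ x) := by
  -- (★★): `e` is forced on `Z`
  have hstar := S.star_star hS hconst hI he hM
  have hZ : ∀ x, (S.F x).2 + S.t.2 = 0 → Q x = γ + 1 := by
    intro x hx
    have e0 : ∀ s g : ZMod 2, s + g = 0 → s = g := by decide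
    have h1 := hstar x (e0 _ _ hx)
    rw [hu] at h1
    have e1 : ∀ g s : ZMod 2, g + s = 1 → s = g + 1 := by decide
    exact e1 _ _ h1
  rcases forcing_cases hB hB' hrank hZ with h | h | h | h
  · -- `Z = ∅` contradicts chord-minimality
    exfalso
    refine not_chordMinimal_of_Z_empty S hS (fun a ha => ?_) e hM
    have e2 : ∀ s g : ZMod 2, s + g = 1 → s ≠ g := by decide
    exact e2 _ _ (h a) ha
  · exact Or.inl h
  · exact Or.inr (Or.inl h)
  · exact Or.inr (Or.inr h)

end Summit.PneNP.PneNP.Theorems.PstarChordForcing
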